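import Summits.KontsevichZagierPeriods.KontsevichZagierPeriods.Theorems.RootDecompRelativeModAbsoluteAngleFoldP5

/-! # `RootDecompRelativeModAbsoluteAngleFoldP6` — part 6/9 of the mechanical ≤400-line split of `af_src.lean` (sha256 2a2742458ba4dd14…)
Source: decomp-kz lens-3 g14 AngleFold.lean @5fd37862 (lint-fixed copy @30e24be4 by writer g8 per critic g6-12): ANGLE ADDITION IN FAMILIES — angleCellwiseFoldAt_one : AngleCellwiseFoldAt 1 PROVED (critic CLEARED g6-12 l.1335); --supports stmt-KontsevichZagierPeriods-30572.
Split by census-1 g10 `gen/splitlean.py`: scopes re-opened with their `open`/`variable`/`set_option` context; mathematics and declaration order unchanged. -/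

noncomputable section
open Set MeasureTheory
open Literature.NumberTheory.Transcendental Literature.ModelTheory.ExponentialFields
namespace Summit.KontsevichZagierPeriods.RootDecompRelativeModAbsolute.Rung30571.RegularisedLogLayer.CylLog.Leaf.G13
open Set MeasureTheory in
open Literature.NumberTheory.Transcendental Literature.ModelTheory.ExponentialFields in
/-- `[r] + [r.neg] ∈ relations`. -/
private theorem of_add_of_neg_mem_relations {n : ℕ} (r : KZ.IntegralRep n) : KZ.of r + KZ.of r.neg ∈ KZ.relations := by
  obtain ⟨Z, hZd, hZi⟩ := KZ.exists_zeroRep r.isSemialgebraic_domain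
  have hZ : KZ.of Z ∈ KZ.relations := KZ.of_mem_relations_of_eqOn_zero Z (fun z _ => by simp [hZi])
  have h1 : KZ.of Z - KZ.of r - KZ.of r.neg ∈ KZ.relations :=
    KZ.integrandAddRel_subset_relations ⟨n, Z, r, r.neg, hZd.symm, by rw [KZ.IntegralRep.domain_neg, hZd],
      fun z _ => by simp [hZi], rfl⟩
  convert KZ.relations.sub_mem hZ h1 using 1
  abel

namespace AngleFold

/-- Auxiliary step `inc_piece`: inc piece. [bookkeeping] -/
theorem inc_piece {T : Set (Fin 1 → ℝ)} (hT : IsSemialgebraic ℚ T) (hTo : IsOpen T) (hTc : OrdConv T)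
    (hne : T.Nonempty) {p u : (Fin 1 → ℝ) → ℝ} (hp : IsSemialgebraicFunOn ℚ T p) (hu : IsSemialgebraicFunOn ℚ T u)
    (hu0 : ∀ x ∈ T, 0 ≤ u x) (hud : ∀ x ∈ T, DifferentiableAt ℝ u x) (hdu : ∀ x ∈ T, 0 < du u x)
    (hone : (∀ x ∈ T, u x ≤ 1) ∨ (∀ x ∈ T, 1 ≤ u x))
    (A : KZ.IntegralRep 2) (hAd : A.domain = KZlog.band T (fun _ => 0) u)
    (hAi : EqOn A.integrand (fun z => p (Fin.init z) / (1 + z (Fin.last 1) ^ 2)) A.domain)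
    (hint : IntegrableOn (fun x => p x * Real.arctan (u x)) T)
    (hloc : ∀ x₁ ∈ T, IntegrableOn p {x | x ∈ T ∧ x 0 ≤ x₁ 0}) :
    ∃ (e : ℝ) (R1 K W : KZ.IntegralRep 2), (∀ x ∈ T, 0 < u x) ∧ 0 ≤ e ∧ SaConst T e ∧
      R1.domain = KZlog.band T (fun _ => 0) (fun _ => 1) ∧
      R1.integrand = (fun z => p (Fin.init z) / (1 + z (Fin.last 1) ^ 2)) ∧
      K.domain = KZlog.band T (fun _ => 0) (fun _ => e) ∧
      K.integrand = (fun z => p (Fin.init z) / (1 + z (Fin.last 1) ^ 2)) ∧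
      W.domain = Rgn T ∧ W.integrand = wfun p u ∧
      cl A = cl R1 + cl R1 - cl K - cl W ∧
      ∀ δ > 0, ∃ x₁ ∈ T, ∀ x ∈ T, x₁ 0 ≤ x 0 → |Real.arctan ((u x)⁻¹) - Real.arctan e| < δ := by
  have hTm : MeasurableSet T := IsSemialgebraic.measurableSet_holds hT
  set uR : ℝ → ℝ := fun s => u (bpt s) with huR
  have hderR : ∀ s ∈ bpt ⁻¹' T, HasDerivAt uR (du u (bpt s)) s := fun s hs => hasDerivAt_comp_bpt (hud _ hs)
  have hmono : StrictMonoOn uR (bpt ⁻¹' T) := strictMonoOn_of_du_pos hTo hTc hud hdu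
  have hlt_of_lt : ∀ x ∈ T, ∀ y ∈ T, x 0 < y 0 → u x < u y := fun x hx y hy hxy => by
    have := hmono (mem_preimage_bpt hx) (mem_preimage_bpt hy) hxy
    simpa only [huR, bpt_apply_zero] using this
  have hpos : ∀ x ∈ T, 0 < u x := fun x hx => by
    obtain ⟨y, hy, hyx⟩ := exists_mem_lt hTo hx
    exact (hu0 y hy).trans_lt (hlt_of_lt y hy x hx hyx)
  -- the reciprocal edge `v = 1/u`
  set v : (Fin 1 → ℝ) → ℝ := fun x => (u x)⁻¹ with hv
  have hvsa : IsSemialgebraicFunOn ℚ T v := (hu.inv fun x hx => (hpos x hx).ne').congr fun _ _ => rfl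
  have hvpos : ∀ x ∈ T, 0 < v x := fun x hx => inv_pos.2 (hpos x hx)
  have hv0 : ∀ x ∈ T, 0 ≤ v x := fun x hx => (hvpos x hx).le
  have hvd : ∀ x ∈ T, DifferentiableAt ℝ v x := fun x hx => (hud x hx).inv (hpos x hx).ne'
  have hvR : ∀ s ∈ bpt ⁻¹' T, HasDerivAt (fun s => v (bpt s)) (-(du u (bpt s)) / u (bpt s) ^ 2) s :=
    fun s hs => (hderR s hs).inv (hpos _ hs).ne'
  have hduv : ∀ x ∈ T, du v x = -(du u x) / u x ^ 2 := fun x hx => by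
    have hx' : DifferentiableAt ℝ v (bpt (x 0)) := by rw [bpt_apply_zero]; exact hvd x hx
    have h1 := hasDerivAt_comp_bpt hx'
    have h2 := hvR (x 0) (mem_preimage_bpt hx)
    have := h1.unique h2
    rwa [bpt_apply_zero] at this
  have hdv : ∀ x ∈ T, du v x < 0 := fun x hx => by
    rw [hduv x hx]
    exact div_neg_of_neg_of_pos (neg_lt_zero.2 (hdu x hx)) (pow_pos (hpos x hx) 2)
  -- `p ∈ L¹(T)`
  obtain ⟨x₂, hx₂⟩ := hne
  have hpL1 : IntegrableOn p T := by
    set a := Real.arctan (u x₂) with ha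
    have ha0 : 0 < a := Real.arctan_pos.2 (hpos x₂ hx₂)
    have hS2m : MeasurableSet {x | x ∈ T ∧ x₂ 0 < x 0} :=
      (hTo.inter (isOpen_lt continuous_const (continuous_apply 0))).measurableSet
    have hsub : {x | x ∈ T ∧ x₂ 0 < x 0} ⊆ T := fun x hx => hx.1
    have h2 : IntegrableOn p {x | x ∈ T ∧ x₂ 0 < x 0} := by
      refine Integrable.mono' (((hint.mono_set hsub).norm).div_const a)
        ((KZ.aestronglyMeasurable_of_isSemialgebraicFunOn hp hTm).mono_measure
          (Measure.restrict_mono hsub le_rfl)) ?_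
      refine (ae_restrict_iff' hS2m).2 (Filter.Eventually.of_forall fun x hx => ?_)
      have h1 : a ≤ Real.arctan (u x) := Real.arctan_strictMono.monotone (hlt_of_lt x₂ hx₂ x hx.1 hx.2).le
      rw [Real.norm_eq_abs, Real.norm_eq_abs, abs_mul, abs_of_pos (ha0.trans_le h1), le_div_iff₀ ha0]
      exact mul_le_mul_of_nonneg_left h1 (abs_nonneg _)
    have := (hloc x₂ hx₂).union h2
    refine this.mono_set fun x hx => ?_
    by_cases h : x 0 ≤ x₂ 0
    · exact Or.inl ⟨hx, h⟩
    · exact Or.inr ⟨hx, lt_of_not_ge h⟩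
  have hint1 : IntegrableOn (fun x => p x * Real.arctan 1) T := hpL1.mul_const _
  have hintv : IntegrableOn (fun x => p x * Real.arctan (v x)) T := by
    refine Integrable.mono' ((hpL1.norm).mul_const (Real.pi / 2))
      ((KZ.aestronglyMeasurable_of_isSemialgebraicFunOn hp hTm).mul
        (Real.continuous_arctan.comp_aestronglyMeasurable
          (KZ.aestronglyMeasurable_of_isSemialgebraicFunOn hvsa hTm))) ?_
    refine Filter.Eventually.of_forall fun x => ?_
    rw [Real.norm_eq_abs, Real.norm_eq_abs, abs_mul]
    exact mul_le_mul_of_nonneg_left (abs_arctan_le _) (abs_nonneg _)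
  -- the three honest monomials
  let Ru : KZ.IntegralRep 2 := arctanRep hT hu hp hu0 hint
  let Rv : KZ.IntegralRep 2 := arctanRep hT hvsa hp hv0 hintv
  let R1 : KZ.IntegralRep 2 := arctanRep hT (saConst_one hT) hp (fun _ _ => zero_le_one) hint1
  have eA : cl A = cl Ru := cl_eq_of_eqOn (by rw [hAd]; rfl) fun z hz => hAi hz
  -- reciprocity `[u] + [1/u] = 2 [1]`
  have erec : cl Ru + cl Rv = cl R1 + cl R1 := by
    have key : KZ.of Ru + KZ.of Rv - KZ.of R1 - KZ.of R1 ∈ KZ.relations := by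
      rcases hone with hle | hge
      · have h1v : ∀ x ∈ T, 1 ≤ v x := fun x hx => by
          show 1 ≤ (u x)⁻¹
          rw [← one_div]
          exact (one_le_div (hpos x hx)).2 (hle x hx)
        have h := reciprocal_mem_relations (p := p) Rv Ru R1 hT hvsa h1v
          (fun z hz => (hvd _ hz.1).comp z (differentiableAt_init z)) rfl
          (by
            show KZlog.band T (fun _ => (0:ℝ)) u = KZlog.band T (fun _ => 0) (fun y => 1 / v y)
            simp only [hv, one_div, inv_inv])
          rfl rfl rfl rfl
        convert h using 1
        abel
      · exact reciprocal_mem_relations (p := p) Ru Rv R1 hT hu hge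
          (fun z hz => (hud _ hz.1).comp z (differentiableAt_init z)) rfl
          (by
            show KZlog.band T (fun _ => (0:ℝ)) v = KZlog.band T (fun _ => 0) (fun y => 1 / u y)
            simp only [hv, one_div])
          rfl rfl rfl rfl
    have h' : (KZ.of Ru + KZ.of Rv) - (KZ.of R1 + KZ.of R1) ∈ KZ.relations := by
      convert key using 1
      abel
    have := mk_sub_eq h'
    simpa only [map_add, cl] using this
  -- the substitution core for the decreasing edge `v`
  obtain ⟨e, K, Wv, he0, hes, hKd, hKi, hWvd, hWvi, eRv, hlim⟩ :=
    dec_piece hT hTo hTc ⟨x₂, hx₂⟩ hp hvsa hv0 hvd hdv Rv rfl (fun z _ => rfl) hintv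
  -- the Jacobian monomial of `u` is minus that of `v`
  have hRsa : IsSemialgebraic ℚ (Rgn T) := isSemialgebraic_Rgn hT
  have hRm : MeasurableSet (Rgn T) := IsSemialgebraic.measurableSet_holds hRsa
  have hflip : ∀ z ∈ Rgn T, wfun p v z = -wfun p u z := fun z hz => by
    have hξ := hz.2.1
    have hne := (hpos _ hξ).ne'
    have hd := hduv _ hξ
    simp only [wfun]
    rw [hd]
    simp only [hv]
    field_simp
    ring
  have hWint : IntegrableOn (wfun p u) (Rgn T) := by
    have h := Wv.integrableOn
    rw [hWvd, hWvi] at h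
    exact (h.neg).congr_fun (fun z hz => by rw [Pi.neg_apply, hflip z hz, neg_neg]) hRm
  let W : KZ.IntegralRep 2 := ⟨Rgn T, wfun p u, hRsa, sa_wfun hT hTo hp hu hud, hWint⟩
  have eW : cl Wv = -cl W := by
    have e1 : cl W.neg = cl Wv := cl_eq_of_eqOn (by rw [hWvd]; rfl) fun z hz => by
      show -wfun p u z = Wv.integrand z
      rw [hWvi, hflip z hz]
    have e2 : cl W + cl W.neg = 0 := by
      show mk _ + mk _ = 0
      rw [← map_add, mk_eq_zero_iff]; exact of_add_of_neg_mem_relations W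
    rw [← e1]; exact eq_neg_of_add_eq_zero_right e2
  refine ⟨e, R1, K, W, hpos, he0, hes, rfl, rfl, hKd, hKi, rfl, rfl, ?_, hlim⟩
  rw [eA]
  calc cl Ru = cl R1 + cl R1 - cl Rv := eq_sub_of_add_eq erec
    _ = cl R1 + cl R1 - (cl K - cl Wv) := by rw [eRv]
    _ = cl R1 + cl R1 - cl K - cl W := by rw [eW]; abel

/-! ### §B5 The per-edge package and the half-cell theorem. -/

/-- Auxiliary step `eq_of_forall_abs_sub_le` (§B5): eq of forall abs sub le. [bookkeeping] -/
theorem eq_of_forall_abs_sub_le {a b C : ℝ} (hC : 0 ≤ C) (h : ∀ δ > 0, |a - b| ≤ C * δ) : a = b := by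
  by_contra hne
  have hε : 0 < |a - b| := abs_pos.2 (sub_ne_zero.2 hne)
  have h2 := h (|a - b| / (2 * (C + 1))) (by positivity)
  have key : C * (|a - b| / (2 * (C + 1))) < |a - b| := by
    have h1 : C / (2 * (C + 1)) < 1 := by rw [div_lt_one (by positivity)]; linarith
    calc C * (|a - b| / (2 * (C + 1))) = |a - b| * (C / (2 * (C + 1))) := by ring
      _ < |a - b| * 1 := mul_lt_mul_of_pos_left h1 hε
      _ = |a - b| := mul_one _
  linarith

/-- Auxiliary step `band_congr` (§B5): band congr. [bookkeeping] -/
theorem band_congr {m : ℕ} {σ : Set (Fin m → ℝ)} {a b b' : (Fin m → ℝ) → ℝ} (h : EqOn b b' σ) :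
    KZlog.band σ a b = KZlog.band σ a b' := by
  ext z
  simp only [KZlog.mem_band]
  constructor
  · rintro ⟨hx, h1, h2⟩; exact ⟨hx, h1, by rw [← h hx]; exact h2⟩
  · rintro ⟨hx, h1, h2⟩; exact ⟨hx, h1, by rw [h hx]; exact h2⟩

/-- A function with vanishing coordinate derivative on an open order-convex subset of the line is constant. -/
theorem const_of_du_eq_zero {T : Set (Fin 1 → ℝ)} (hTo : IsOpen T) (hTc : OrdConv T) {u : (Fin 1 → ℝ) → ℝ}
    (hud : ∀ x ∈ T, DifferentiableAt ℝ u x) (hdu : ∀ x ∈ T, du u x = 0) : ∀ x ∈ T, ∀ y ∈ T, u x = u y := by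
  have hTR := isOpen_preimage_bpt hTo
  have hconv := convex_preimage_bpt hTc
  have hder : ∀ s ∈ bpt ⁻¹' T, HasDerivAt (fun s => u (bpt s)) (du u (bpt s)) s :=
    fun s hs => hasDerivAt_comp_bpt (hud _ hs)
  have hcont : ContinuousOn (fun s => u (bpt s)) (bpt ⁻¹' T) :=
    fun s hs => (hder s hs).continuousAt.continuousWithinAt
  have hdiff : DifferentiableOn ℝ (fun s => u (bpt s)) (interior (bpt ⁻¹' T)) := by
    rw [hTR.interior_eq]; exact fun s hs => (hder s hs).differentiableAt.differentiableWithinAt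
  have hanti : AntitoneOn (fun s => u (bpt s)) (bpt ⁻¹' T) :=
    antitoneOn_of_deriv_nonpos hconv hcont hdiff fun s hs => by
      rw [hTR.interior_eq] at hs; rw [(hder s hs).deriv, hdu _ hs]
  have hmono : MonotoneOn (fun s => u (bpt s)) (bpt ⁻¹' T) :=
    monotoneOn_of_deriv_nonneg hconv hcont hdiff fun s hs => by
      rw [hTR.interior_eq] at hs; rw [(hder s hs).deriv, hdu _ hs]
  intro x hx y hy
  have hx' := mem_preimage_bpt hx
  have hy' := mem_preimage_bpt hy
  rcases le_total (x 0) (y 0) with h | h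
  · have h1 := hmono hx' hy' h
    have h2 := hanti hx' hy' h
    simp only [bpt_apply_zero] at h1 h2
    exact le_antisymm h1 h2
  · have h1 := hmono hy' hx' h
    have h2 := hanti hy' hx' h
    simp only [bpt_apply_zero] at h1 h2
    exact le_antisymm h2 h1

/-- **The per-edge package** on a half-cell `T` (top end bad): three constant-top monomials and one Jacobian monomial
with `[A] = Σₖ [Vₖ] − [W]`, and the angles `arctan u(x) → Σₖ cₖ arctan dₖ` towards the top end. -/
theorem edge_package {T : Set (Fin 1 → ℝ)} (hT : IsSemialgebraic ℚ T) (hTo : IsOpen T) (hTc : OrdConv T)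
    (hne : T.Nonempty) {p u : (Fin 1 → ℝ) → ℝ} (hp : IsSemialgebraicFunOn ℚ T p) (hu : IsSemialgebraicFunOn ℚ T u)
    (hu0 : ∀ x ∈ T, 0 ≤ u x) (hud : ∀ x ∈ T, DifferentiableAt ℝ u x)
    (hsgn : (∀ x ∈ T, du u x = 0) ∨ (∀ x ∈ T, du u x < 0) ∨ (∀ x ∈ T, 0 < du u x))
    (hone : (∀ x ∈ T, u x ≤ 1) ∨ (∀ x ∈ T, 1 ≤ u x))
    (A : KZ.IntegralRep 2) (hAd : A.domain = KZlog.band T (fun _ => 0) u)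
    (hAi : EqOn A.integrand (fun z => p (Fin.init z) / (1 + z (Fin.last 1) ^ 2)) A.domain)
    (hint : IntegrableOn (fun x => p x * Real.arctan (u x)) T)
    (hloc : ∀ x₁ ∈ T, IntegrableOn p {x | x ∈ T ∧ x 0 ≤ x₁ 0}) :
    ∃ (dv : Fin 3 → ℝ) (cv : Fin 3 → ℤ) (V : Fin 3 → KZ.IntegralRep 2) (W : KZ.IntegralRep 2),
      (∀ k, 0 ≤ dv k) ∧ (∀ k, SaConst T (dv k)) ∧
      (∀ k, (V k).domain = KZlog.band T (fun _ => 0) (fun _ => dv k)) ∧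
      (∀ k, EqOn (V k).integrand (fun z => (cv k : ℝ) * p (Fin.init z) / (1 + z (Fin.last 1) ^ 2)) (V k).domain) ∧
      W.domain = Rgn T ∧ W.integrand = wfun p u ∧
      cl A = ∑ k, cl (V k) - cl W ∧
      ∀ δ > 0, ∃ x₁ ∈ T, ∀ x ∈ T, x₁ 0 ≤ x 0 →
        |Real.arctan (u x) - ∑ k, (cv k : ℝ) * Real.arctan (dv k)| < δ := by
  have hTm : MeasurableSet T := IsSemialgebraic.measurableSet_holds hT
  have hRsa : IsSemialgebraic ℚ (Rgn T) := isSemialgebraic_Rgn hT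
  have hRm : MeasurableSet (Rgn T) := IsSemialgebraic.measurableSet_holds hRsa
  obtain ⟨x₂, hx₂⟩ := hne
  -- the zero monomial on the slice `band T 0 0`
  have h0band : IsSemialgebraic ℚ (KZlog.band T (fun _ => (0:ℝ)) (fun _ => 0)) :=
    KZlog.isSemialgebraic_band (saConst_zero hT) (saConst_zero hT)
  obtain ⟨Z, hZd, hZi⟩ := KZ.exists_zeroRep h0band
  have hZcl : cl Z = 0 := cl_eq_zero_of_eqOn_zero Z (by rw [hZi]; exact fun _ _ => rfl)
  have hZi' : EqOn Z.integrand (fun z => ((0:ℤ) : ℝ) * p (Fin.init z) / (1 + z (Fin.last 1) ^ 2)) Z.domain :=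
    fun z _ => by rw [hZi]; simp
  rcases hsgn with hc | hdec | hinc
  · -- a constant edge
    have hconst : ∀ x ∈ T, u x = u x₂ := fun x hx => const_of_du_eq_zero hTo hTc hud hc x hx x₂ hx₂
    have hcs : SaConst T (u x₂) := hu.congr fun x hx => hconst x hx
    have hintc : IntegrableOn (fun x => p x * Real.arctan (u x₂)) T :=
      hint.congr_fun (fun x hx => by
        show p x * Real.arctan (u x) = p x * Real.arctan (u x₂)
        rw [hconst x hx]) hTm
    let Ac : KZ.IntegralRep 2 := arctanRep hT hcs hp (fun _ _ => hu0 x₂ hx₂) hintc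
    have hAcd : Ac.domain = KZlog.band T (fun _ => 0) (fun _ => u x₂) := rfl
    have eA : cl A = cl Ac :=
      cl_eq_of_eqOn (by rw [hAd, hAcd]; exact band_congr (a := fun _ => 0) fun x hx => (hconst x hx).symm)
        fun z hz => hAi hz
    have hw0 : ∀ z ∈ Rgn T, wfun p u z = 0 := fun z hz => by
      simp only [wfun, hc _ hz.2.1, mul_zero, zero_div]
    let W : KZ.IntegralRep 2 := ⟨Rgn T, wfun p u, hRsa, sa_wfun hT hTo hp hu hud,
      integrableOn_zero.congr_fun (fun z hz => (hw0 z hz).symm) hRm⟩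
    have hWcl : cl W = 0 := cl_eq_zero_of_eqOn_zero W fun z hz => hw0 z hz
    refine ⟨![u x₂, 0, 0], ![1, 0, 0], ![Ac, Z, Z], W, ?_, ?_, ?_, ?_, rfl, rfl, ?_, ?_⟩
    · intro k; fin_cases k; exacts [hu0 x₂ hx₂, le_rfl, le_rfl]
    · intro k; fin_cases k; exacts [hcs, saConst_zero hT, saConst_zero hT]
    · intro k; fin_cases k; exacts [rfl, hZd, hZd]
    · intro k; fin_cases k
      · intro z _
        show p (Fin.init z) / (1 + z (Fin.last 1) ^ 2) = ((1:ℤ) : ℝ) * p (Fin.init z) / (1 + z (Fin.last 1) ^ 2)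
        simp
      · exact hZi'
      · exact hZi'
    · rw [Fin.sum_univ_three]
      show cl A = cl Ac + cl Z + cl Z - cl W
      rw [hZcl, hWcl, eA]; abel
    · intro δ hδ
      refine ⟨x₂, hx₂, fun x hx _ => ?_⟩
      rw [Fin.sum_univ_three]
      show |Real.arctan (u x) - (((1:ℤ) : ℝ) * Real.arctan (u x₂) + ((0:ℤ) : ℝ) * Real.arctan 0 +
        ((0:ℤ) : ℝ) * Real.arctan 0)| < δ
      rw [hconst x hx]; simpa using hδ
  · -- an edge decreasing towards the top end
    obtain ⟨d, K, W, hd0, hds, hKd, hKi, hWd, hWi, eA, hlim⟩ :=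
      dec_piece hT hTo hTc ⟨x₂, hx₂⟩ hp hu hu0 hud hdec A hAd hAi hint
    refine ⟨![d, 0, 0], ![1, 0, 0], ![K, Z, Z], W, ?_, ?_, ?_, ?_, hWd, hWi, ?_, ?_⟩
    · intro k; fin_cases k; exacts [hd0, le_rfl, le_rfl]
    · intro k; fin_cases k; exacts [hds, saConst_zero hT, saConst_zero hT]
    · intro k; fin_cases k; exacts [hKd, hZd, hZd]
    · intro k; fin_cases k
      · intro z _
        show K.integrand z = ((1:ℤ) : ℝ) * p (Fin.init z) / (1 + z (Fin.last 1) ^ 2)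
        rw [hKi]; simp
      · exact hZi'
      · exact hZi'
    · rw [Fin.sum_univ_three]
      show cl A = cl K + cl Z + cl Z - cl W
      rw [hZcl, eA]; abel
    · intro δ hδ
      obtain ⟨x₁, hx₁, h⟩ := hlim δ hδ
      refine ⟨x₁, hx₁, fun x hx hle => ?_⟩
      rw [Fin.sum_univ_three]
      show |Real.arctan (u x) - (((1:ℤ) : ℝ) * Real.arctan d + ((0:ℤ) : ℝ) * Real.arctan 0 +
        ((0:ℤ) : ℝ) * Real.arctan 0)| < δ
      simpa using h x hx hle
  · -- an edge increasing towards the top end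
    obtain ⟨e, R1, K, W, hpos, he0, hes, hR1d, hR1i, hKd, hKi, hWd, hWi, eA, hlim⟩ :=
      inc_piece hT hTo hTc ⟨x₂, hx₂⟩ hp hu hu0 hud hinc hone A hAd hAi hint hloc
    have hKneg : cl K.neg = -cl K := by
      have e2 : cl K + cl K.neg = 0 := by
        show mk _ + mk _ = 0
        rw [← map_add, mk_eq_zero_iff]; exact of_add_of_neg_mem_relations K
      exact eq_neg_of_add_eq_zero_right e2
    refine ⟨![1, 1, e], ![1, 1, -1], ![R1, R1, K.neg], W, ?_, ?_, ?_, ?_, hWd, hWi, ?_, ?_⟩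
    · intro k; fin_cases k; exacts [zero_le_one, zero_le_one, he0]
    · intro k; fin_cases k; exacts [saConst_one hT, saConst_one hT, hes]
    · intro k; fin_cases k; exacts [hR1d, hR1d, hKd]
    · intro k; fin_cases k
      · intro z _
        show R1.integrand z = ((1:ℤ) : ℝ) * p (Fin.init z) / (1 + z (Fin.last 1) ^ 2)
        rw [hR1i]; simp
      · intro z _
        show R1.integrand z = ((1:ℤ) : ℝ) * p (Fin.init z) / (1 + z (Fin.last 1) ^ 2)
        rw [hR1i]; simp
      · intro z _
        show K.neg.integrand z = ((-1:ℤ) : ℝ) * p (Fin.init z) / (1 + z (Fin.last 1) ^ 2)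
        rw [KZ.IntegralRep.integrand_neg, Pi.neg_apply, hKi]; simp [neg_div]
    · rw [Fin.sum_univ_three]
      show cl A = cl R1 + cl R1 + cl K.neg - cl W
      rw [hKneg, eA]; abel
    · intro δ hδ
      obtain ⟨x₁, hx₁, h⟩ := hlim δ hδ
      refine ⟨x₁, hx₁, fun x hx hle => ?_⟩
      have h1 := h x hx hle
      rw [Real.arctan_inv_of_pos (hpos x hx)] at h1
      rw [Fin.sum_univ_three]
      show |Real.arctan (u x) - (((1:ℤ) : ℝ) * Real.arctan 1 + ((1:ℤ) : ℝ) * Real.arctan 1 +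
        ((-1:ℤ) : ℝ) * Real.arctan e)| < δ
      push_cast
      rw [Real.arctan_one, show Real.arctan (u x) - (1 * (Real.pi / 4) + 1 * (Real.pi / 4) + -1 * Real.arctan e) =
        -(Real.pi / 2 - Real.arctan (u x) - Real.arctan e) by ring, abs_neg]
      exact h1

end AngleFold
end Summit.KontsevichZagierPeriods.RootDecompRelativeModAbsolute.Rung30571.RegularisedLogLayer.CylLog.Leaf.G13
end
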